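/-
Copyright (c) 2026 the pub-hodgecm-mathlib formalisation cell (harness21).  Prover seat hodgecm-mathlib-B-p14 (g35): road «S3-tree» (LEAD F0P3a-plan (g11) WORD T10-2; architect A-p16 (g28)
census «S3» v3 = DEAL SHEET, acting architect F0P3-p01 (g16)), brick T1 «the `U(3)_v` tree», file T1d-C3a = THE PARENT OF A CHILD VERTEX AND THE THREE-CASE ASSEMBLY; 2026-09-01.
-/
import Literature.NumberTheory.Automorphic.UnitaryLatticeTreeTypeTwoParent   -- ★ T1d-C2 (B-p14 (g35)): apartment case, child depth, `latticeParent_spec_of_lt_stdLattice`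
import HarnessLib

/-!
# The lattice graph of a hermitian space — IX: THE PARENT OF A CHILD `t_a·κ″·N₁` IS `L_a`; EVERY TYPE-TWO VERTEX of the `U(3)` tree HAS A SELF-DUAL PARENT ONE DEPTH UP
# (Bruhat–Tits 1972 §10; Serre, *Trees* II.1.1)

Topic `NumberTheory/Automorphic`; namespace `Literature.NumberTheory.Automorphic.UnitaryLatticeTree`.  THEOREMS ONLY (no definition, no instance, no notation, no named fact,
no `sorry`); kernel lane.  Cell `pub/hodgecm-mathlib` (D-0151), crux H413 = `stmt-HodgeConjecture-24833`; road «S3-tree», brick **T1**, sequel of ★ `UnitaryLatticeTreeTypeTwoParent`.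
With ★ `latticeParent_spec_of_isSelfDualLattice` (T1d-B) the assembly below is the whole rooted structure consumed by T1d-C3 (`isTree`): every non-root vertex has a parent
that is a vertex, adjacent, and exactly one LEVEL up (`level = 2·depth` on self-dual vertices, `2·depth − 1` on type-two vertices).
HONEST LABEL: HC_CM is proved only modulo the 2 remaining named inputs (hLiu418 24832, h413 24833) until rung 0 closes; nothing printed is asserted here (elementary lattice
algebra over a valuation ring); the type-two classification enters as the hypothesis `htr₂` (rank-2 (hB) analogue), discharged separately; S3 stays a print row until the road's END lands.

* §24 `dualLatt_N₁` (`N₁^♯ = latt diag(ϖ⁻¹,1,1)`), `isIntMatrix_antidiagonal` ∕ `isIntMatrix_antidiagonal_inv`, `diagonal_const_three`, **`latticeParent_child`** (`a ≥ 1`, `x₂` a unit: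
  the parent of `t_a·κ″·N₁` is `L_a = latt diag(ϖ^a,1,ϖ^{-a})`).
* §25 the assembly **`latticeParent_spec_of_isVertexLattice_two`** (`N = 3`, over `hd : UnramifiedLocalConjDatum σ ϖ` and `htr₂`): the parent of a type-two vertex is SELF-DUAL, lies
  strictly above it, and `depth(parent) + 1 = depth`.

## References
* [BruhatTits1972] F. Bruhat, J. Tits, *Groupes réductifs sur un corps local I*, Publ. Math. IHÉS 41 (1972), §10.
* [Tits1979] J. Tits, *Reductive groups over local fields*, PSPM 33.1 (1979), §3.3.3.
* [Serre1980Trees] J.-P. Serre, *Trees* (1980), Ch. II §1.1.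
* [Jacobowitz1962] R. Jacobowitz, *Hermitian forms over local fields*, Amer. J. Math. 84 (1962), §7–§8.
-/

set_option autoImplicit false

noncomputable section

open scoped Valued WithZero Matrix MatrixGroups

namespace Literature.NumberTheory.Automorphic.UnitaryLatticeTree

open Literature.NumberTheory.Automorphic Literature.NumberTheory.Automorphic.HermitianLattice
open Literature.NumberTheory.Automorphic.CartanUnique

variable {K : Type*} [Field K] [Valued K ℤᵐ⁰] {σ : K →+* K} {ϖ : K} {N : ℕ}

/-! ## §24 The parent of a child vertex `t_a·κ″·N₁` -/

/-- **`N₁^♯ = latt diag(ϖ⁻¹, 1, 1)`** for `N₁ = latt diag(1,1,ϖ)` and the split form `J₀`. [cite: Serre1980Trees, II.1.1] [cite: BruhatTits1972, §10] -/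
theorem dualLatt_N₁ (hvσ : ∀ a, Valued.v (σ a) = Valued.v a) (hσϖ : σ ϖ = ϖ) (hϖ0 : ϖ ≠ 0) :
    dualLatt σ ((StdForm.antidiagonal 3).over K) (latt (Matrix.diagonal ![(1 : K), 1, ϖ])) = latt (Matrix.diagonal ![ϖ ^ (-1 : ℤ), (1 : K), 1]) := by
  have h1 : (Matrix.diagonal ![(1 : K), 1, ϖ] : Matrix (Fin 3) (Fin 3) K) = Matrix.diagonal ![ϖ ^ (0 : ℤ), ϖ ^ (0 : ℤ), ϖ ^ (1 : ℤ)] := by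
    rw [zpow_zero, zpow_one]
  rw [h1, dualLatt_latt_diagonal_three hvσ hσϖ hϖ0, neg_zero, zpow_zero]

omit [Valued K ℤᵐ⁰] in
/-- A constant diagonal matrix on `Fin 3` in `![…]` form. [cite: Serre1980Trees, II.1.1] -/
theorem diagonal_const_three (c : K) : (Matrix.diagonal fun _ : Fin 3 => c) = Matrix.diagonal ![c, c, c] := by
  congr 1; funext i; fin_cases i <;> rfl

/-- `J₀` is an integral matrix. [cite: Tits1979, §3.3.3] -/
theorem isIntMatrix_antidiagonal : IsIntMatrix ((StdForm.antidiagonal N).over K) :=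
  (latt_le_stdLattice_iff _).1 latt_antidiagonal.le

/-- `J₀⁻¹ = J₀` is an integral matrix. [cite: Tits1979, §3.3.3] -/
theorem isIntMatrix_antidiagonal_inv : IsIntMatrix ((StdForm.antidiagonal N).over K)⁻¹ := by
  rw [StdForm.inv_over]; exact isIntMatrix_antidiagonal

/-- The root `𝒪³` is a self-dual vertex for `J₀` (from the apartment vertex `L_0`). [cite: BruhatTits1972, §10] -/
theorem isSelfDualLattice_stdLattice_three (hd : UnramifiedLocalConjDatum σ ϖ) : IsSelfDualLattice σ ϖ ((StdForm.antidiagonal 3).over K) (stdLattice K 3) := by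
  have hϖ0 : ϖ ≠ 0 := uniformizer_ne_zero hd.vϖ
  have hϖ1 : Valued.v ϖ ≤ 1 := by rw [hd.vϖ, ← WithZero.exp_zero, WithZero.exp_le_exp]; omega
  have h := isSelfDualLattice_latt_diagonal_zpow (K := K) hd.σσ hd.σϖ hϖ1 hϖ0 0
  rwa [latt_diagonal_zpow_zero] at h

/-- **THE CHILD CASE — PARENT**: for `a ≥ 1`, `κ″ ∈ K₀` with `(κ″e₀)₂` a unit and `t = t_a`, the parent of the type-two vertex `t·κ″·N₁` (depth `a + 1`) is the apartment vertex
`L_a = latt diag(ϖ^a, 1, ϖ^{-a})`: indeed `(t·X)^♯ ⊓ ϖ^{-a}𝒪³ = t·𝒪³` because a vector of `t·X^♯ = t·κ″·latt diag(ϖ⁻¹,1,1)` with integral `ϖ^a`-scaled last coordinate has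
`x₂·ϖ⁻¹w₀ ∈ 𝒪`, `x₂` a unit. [cite: BruhatTits1972, §10] [cite: Serre1980Trees, II.1.1] -/
theorem latticeParent_child (hd : UnramifiedLocalConjDatum σ ϖ) {κ'' : unitaryGroupOfForm σ ((StdForm.antidiagonal 3).over K)}
    (hκ'' : κ'' ∈ unitaryInt σ ((StdForm.antidiagonal 3).over K)) {t : unitaryGroupOfForm σ ((StdForm.antidiagonal 3).over K)} {a : ℕ} (ha : 1 ≤ a)
    (ht : ((t : GL (Fin 3) K) : Matrix (Fin 3) (Fin 3) K) = Matrix.diagonal ![ϖ ^ (a : ℤ), 1, ϖ ^ (-(a : ℤ))])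
    (hx2 : Valued.v (((κ'' : GL (Fin 3) K) : Matrix (Fin 3) (Fin 3) K).mulVec (Pi.single 0 1) 2) = 1) :
    latticeParent σ ϖ ((StdForm.antidiagonal 3).over K) (mapGL (t : GL (Fin 3) K) (mapGL (κ'' : GL (Fin 3) K) (latt (Matrix.diagonal ![(1 : K), 1, ϖ])))) =
      latt (Matrix.diagonal ![ϖ ^ (a : ℤ), (1 : K), ϖ ^ (-(a : ℤ))]) := by
  have hϖ0 : ϖ ≠ 0 := uniformizer_ne_zero hd.vϖ
  have hϖ1 : Valued.v ϖ ≤ 1 := by rw [hd.vϖ, ← WithZero.exp_zero, WithZero.exp_le_exp]; omega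
  have htL : mapGL (t : GL (Fin 3) K) (stdLattice K 3) = latt (Matrix.diagonal ![ϖ ^ (a : ℤ), (1 : K), ϖ ^ (-(a : ℤ))]) := by
    rw [← latt_one, mapGL_coe_latt_eq t ht, Matrix.mul_one]
  have hXle := (mapGL_N₁_le hκ'' hϖ1 hϖ0).2
  have hexp : (1 - ((a + 1 : ℕ) : ℤ)) = -(a : ℤ) := by push_cast; ring
  rw [latticeParent, latticeDepth_child hd hκ'' ha ht hx2, hexp, ← htL, dualLatt_mapGL t.2]
  refine le_antisymm ?_ (le_inf ((mapGL_le_mapGL_iff _ _ _).2 ?_) ?_)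
  · -- `⊆`: a vector of `t·X^♯` whose last coordinate is `ϖ^{-a}`-integral lies in `t·𝒪³`
    intro y hy
    obtain ⟨hy1, hy2⟩ := Submodule.mem_inf.1 hy
    rw [dualLatt_mapGL κ''.2, dualLatt_N₁ hd.vσ hd.σϖ hϖ0, mapGL_latt_eq, mapGL_latt_eq, ht] at hy1
    obtain ⟨w, hw, hwy⟩ := Submodule.mem_map.1 hy1
    simp only [LinearMap.restrictScalars_apply, Matrix.toLin'_apply, ← Matrix.mulVec_mulVec] at hwy
    set u : Fin 3 → K := (Matrix.diagonal ![ϖ ^ (-1 : ℤ), (1 : K), 1]).mulVec w with hu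
    -- the last coordinate of `z = κ″u`
    have hz2 : Valued.v ((((κ'' : GL (Fin 3) K) : Matrix (Fin 3) (Fin 3) K).mulVec u) 2) ≤ 1 := by
      have hy2' := (mem_scaleLattice_stdLattice_iff (zpow_ne_zero _ hϖ0) y).1 hy2 2
      have hyz : y 2 = ϖ ^ (-(a : ℤ)) * (((κ'' : GL (Fin 3) K) : Matrix (Fin 3) (Fin 3) K).mulVec u) 2 := by
        rw [← hwy, Matrix.mulVec_diagonal]; rfl
      have hback : (((κ'' : GL (Fin 3) K) : Matrix (Fin 3) (Fin 3) K).mulVec u) 2 = ϖ ^ (a : ℤ) * y 2 := by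
        rw [hyz, ← mul_assoc, ← zpow_add₀ hϖ0, add_neg_cancel, zpow_zero, one_mul]
      rw [hback, map_mul]
      calc Valued.v (ϖ ^ (a : ℤ)) * Valued.v (y 2) ≤ Valued.v (ϖ ^ (a : ℤ)) * Valued.v (ϖ ^ (-(a : ℤ))) := mul_le_mul_right hy2' _
        _ = 1 := by rw [← map_mul, ← zpow_add₀ hϖ0, add_neg_cancel, zpow_zero, map_one]
    -- hence `u₀ = ϖ⁻¹w₀ ∈ 𝒪`, `x₂` being a unit
    have hK : ∀ i j, Valued.v (((κ'' : GL (Fin 3) K) : Matrix (Fin 3) (Fin 3) K) i j) ≤ 1 := (mem_unitaryInt_iff.1 hκ'').1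
    have hx2' : Valued.v (((κ'' : GL (Fin 3) K) : Matrix (Fin 3) (Fin 3) K) 2 0) = 1 := by
      rw [Matrix.mulVec_single_one, Matrix.col_apply] at hx2; exact hx2
    have hw' := (mem_stdLattice.1 hw)
    have hu1 : u 1 = w 1 := by rw [hu, Matrix.mulVec_diagonal]; simp
    have hu2 : u 2 = w 2 := by rw [hu, Matrix.mulVec_diagonal]; simp
    have hsum : (((κ'' : GL (Fin 3) K) : Matrix (Fin 3) (Fin 3) K).mulVec u) 2 =
        ((κ'' : GL (Fin 3) K) : Matrix (Fin 3) (Fin 3) K) 2 0 * u 0 + ((κ'' : GL (Fin 3) K) : Matrix (Fin 3) (Fin 3) K) 2 1 * u 1 +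
          ((κ'' : GL (Fin 3) K) : Matrix (Fin 3) (Fin 3) K) 2 2 * u 2 := by
      simp only [Matrix.mulVec, dotProduct, Fin.sum_univ_three]
    have hu0 : Valued.v (u 0) ≤ 1 := by
      have heq : ((κ'' : GL (Fin 3) K) : Matrix (Fin 3) (Fin 3) K) 2 0 * u 0 =
          (((κ'' : GL (Fin 3) K) : Matrix (Fin 3) (Fin 3) K).mulVec u) 2 - ((κ'' : GL (Fin 3) K) : Matrix (Fin 3) (Fin 3) K) 2 1 * u 1 -
            ((κ'' : GL (Fin 3) K) : Matrix (Fin 3) (Fin 3) K) 2 2 * u 2 := by rw [hsum]; ring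
      have hv : Valued.v (((κ'' : GL (Fin 3) K) : Matrix (Fin 3) (Fin 3) K) 2 0 * u 0) ≤ 1 := by
        rw [heq]
        refine le_trans (Valuation.map_sub _ _ _) (max_le (le_trans (Valuation.map_sub _ _ _) (max_le hz2 ?_)) ?_)
        · rw [map_mul, hu1]; exact mul_le_one' (hK 2 1) (hw' 1)
        · rw [map_mul, hu2]; exact mul_le_one' (hK 2 2) (hw' 2)
      rwa [map_mul, hx2', one_mul] at hv
    have humem : u ∈ stdLattice K 3 := by
      refine mem_stdLattice.2 fun i => ?_
      fin_cases i
      · exact hu0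
      · show Valued.v (u 1) ≤ 1; rw [hu1]; exact hw' 1
      · show Valued.v (u 2) ≤ 1; rw [hu2]; exact hw' 2
    rw [← latt_one, mapGL_coe_latt_eq t ht, Matrix.mul_one, ← hwy]
    exact mulVec_mem_latt _ (mulVec_mem_stdLattice_of_mem_unitaryInt hκ'' humem)
  · -- `𝒪³ ≤ X^♯`
    rw [← dualLatt_stdLattice_eq_self σ hd.vσ isUnit_det_antidiagonal isIntMatrix_antidiagonal isIntMatrix_antidiagonal_inv]
    exact dualLatt_antitone σ _ hXle
  · -- `t·𝒪³ = L_a ≤ ϖ^{-a}𝒪³`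
    rw [htL, scaleLattice_stdLattice_eq_latt_diagonal (zpow_ne_zero _ hϖ0), diagonal_const_three, diagonal_one_mid_eq, latt_diagonal_three_le_iff hd.vϖ]
    omega

/-! ## §25 The assembly: every type-two vertex has a self-dual parent, one depth up -/

/-- **THE PARENT OF A TYPE-TWO VERTEX of the `U(3)` lattice graph is a SELF-DUAL vertex strictly above it, with `depth(parent) + 1 = depth`** (`N = 3`, unramified datum,
`2 ∈ 𝒪^×`; under `htr₂` = «`U(J₀)` acts transitively on type-two vertices», the rank-3 analogue of the rank-2 binder (hB)).  The three cases of the normal form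
★ `exists_normalForm_of_type_two`: `a = 0` (inside the root, ★ `latticeParent_spec_of_lt_stdLattice`); `x₂ ∈ 𝔪` (the apartment vertex `κ·L′_a`,
★ `latticeParent_spec_apartment_two`); `x₂` a unit (a child of `κ·L_a`, ★ `latticeDepth_child` ∕ `latticeParent_child`). [cite: BruhatTits1972, §10] [cite: Serre1980Trees, II.1.1] -/
theorem latticeParent_spec_of_isVertexLattice_two (hd : UnramifiedLocalConjDatum σ ϖ)
    (htr₂ : ∀ M : Submodule 𝒪[K] (Fin 3 → K), IsVertexLattice σ ϖ ((StdForm.antidiagonal 3).over K) 2 M →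
      ∃ u : unitaryGroupOfForm σ ((StdForm.antidiagonal 3).over K), M = mapGL (u : GL (Fin 3) K) (latt (Matrix.diagonal ![(1 : K), 1, ϖ])))
    {M : Submodule 𝒪[K] (Fin 3 → K)} (hM : IsVertexLattice σ ϖ ((StdForm.antidiagonal 3).over K) 2 M) :
    IsSelfDualLattice σ ϖ ((StdForm.antidiagonal 3).over K) (latticeParent σ ϖ ((StdForm.antidiagonal 3).over K) M) ∧
      M < latticeParent σ ϖ ((StdForm.antidiagonal 3).over K) M ∧
      latticeDepth ϖ (latticeParent σ ϖ ((StdForm.antidiagonal 3).over K) M) + 1 = latticeDepth ϖ M := by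
  have hϖ0 : ϖ ≠ 0 := uniformizer_ne_zero hd.vϖ
  have hϖ1 : Valued.v ϖ ≤ 1 := by rw [hd.vϖ, ← WithZero.exp_zero, WithZero.exp_le_exp]; omega
  obtain ⟨κ, hκ, κ'', hκ'', a, hMeq⟩ := exists_normalForm_of_type_two hd htr₂ hM
  obtain ⟨t, ht⟩ := exists_coe_eq_diagonal_zpow hd.σσ hd.σϖ hϖ0 (a : ℤ)
  have hMeq' : M = mapGL (κ : GL (Fin 3) K) (mapGL (t : GL (Fin 3) K) (mapGL (κ'' : GL (Fin 3) K) (latt (Matrix.diagonal ![(1 : K), 1, ϖ])))) := by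
    rw [hMeq, mapGL_latt_eq (κ'' : GL (Fin 3) K), mapGL_coe_latt_eq t ht]
  have hN₁ : IsVertexLattice σ ϖ ((StdForm.antidiagonal 3).over K) 2 (mapGL (κ'' : GL (Fin 3) K) (latt (Matrix.diagonal ![(1 : K), 1, ϖ]))) :=
    isVertexLattice_mapGL σ ϖ _ _ κ''.2 (isVertexLattice_two_latt_diagonal_one_one hd.σϖ hϖ1 hϖ0)
  have hroot := isSelfDualLattice_stdLattice_three (K := K) hd
  -- `κ″·N₁ < 𝒪³`
  have hXlt : mapGL (κ'' : GL (Fin 3) K) (latt (Matrix.diagonal ![(1 : K), 1, ϖ])) < stdLattice K 3 := by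
    refine lt_of_le_of_ne (mapGL_N₁_le hκ'' hϖ1 hϖ0).2 fun heq => ?_
    rw [heq] at hN₁
    exact absurd (type_unique hd.vσ hd.vϖ hN₁ hroot) (by norm_num)
  rcases Nat.eq_zero_or_pos a with rfl | ha
  · -- `a = 0`: `M = κκ″·N₁ < 𝒪³`, depth `1`, parent `𝒪³`
    have ht1 : mapGL (t : GL (Fin 3) K) (mapGL (κ'' : GL (Fin 3) K) (latt (Matrix.diagonal ![(1 : K), 1, ϖ]))) =
        mapGL (κ'' : GL (Fin 3) K) (latt (Matrix.diagonal ![(1 : K), 1, ϖ])) := by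
      rw [mapGL_latt_eq, mapGL_coe_latt_eq t ht, diagonal_zpow_zero_eq_one, Matrix.one_mul]
    have hMlt : M < stdLattice K 3 := by
      rw [hMeq', ht1]
      conv_rhs => rw [← mapGL_stdLattice_of_mem_unitaryInt hκ]
      exact (mapGL_lt_mapGL_iff _ _ _).2 hXlt
    obtain ⟨hdepth, hP⟩ := latticeParent_spec_of_lt_stdLattice hd.vσ hd.vϖ isUnit_det_antidiagonal isIntMatrix_antidiagonal isIntMatrix_antidiagonal_inv hM hMlt
    rw [hP, hdepth, latticeDepth_stdLattice]
    exact ⟨hroot, hMlt, rfl⟩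
  · obtain ⟨hxint, -, -⟩ := firstColumn_props (K := K) hκ''
    rcases (mem_stdLattice.1 hxint 2).lt_or_eq with hx2 | hx2
    · -- `x₂ ∈ 𝔪`: `κ″·N₁ = N₁` and `M = κ·L′_a` — the apartment case
      have hMa : M = mapGL (κ : GL (Fin 3) K) (latt (Matrix.diagonal ![ϖ ^ (a : ℤ), (1 : K), ϖ ^ (1 - (a : ℤ))])) := by
        rw [hMeq', mapGL_N₁_eq_of_v_lt_one hd.vσ hd.σϖ hd.vϖ hκ'' hx2, mapGL_coe_latt_eq t ht, diagonal_three_mul]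
        rw [mul_one, mul_one, ← zpow_add_one₀ hϖ0, neg_add_eq_sub]
      rw [hMa]
      exact latticeParent_spec_apartment_two hd hκ (by exact_mod_cast ha)
    · -- `x₂` a unit: `M` is a child of `κ·L_a`
      have htL : mapGL (t : GL (Fin 3) K) (stdLattice K 3) = latt (Matrix.diagonal ![ϖ ^ (a : ℤ), (1 : K), ϖ ^ (-(a : ℤ))]) := by
        rw [← latt_one, mapGL_coe_latt_eq t ht, Matrix.mul_one]
      have hdM : latticeDepth ϖ M = a + 1 := by
        rw [hMeq', latticeDepth_mapGL_of_mem_unitaryInt hκ, latticeDepth_child hd hκ'' ha ht hx2]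
      have hP : latticeParent σ ϖ ((StdForm.antidiagonal 3).over K) M = mapGL (κ : GL (Fin 3) K) (latt (Matrix.diagonal ![ϖ ^ (a : ℤ), (1 : K), ϖ ^ (-(a : ℤ))])) := by
        rw [hMeq', latticeParent_mapGL_of_mem_unitaryInt hκ, latticeParent_child hd hκ'' ha ht hx2]
      have hsd := isSelfDualLattice_latt_diagonal_zpow (K := K) hd.σσ hd.σϖ hϖ1 hϖ0 (a : ℤ)
      refine ⟨by rw [hP]; exact isVertexLattice_mapGL σ ϖ _ _ κ.2 hsd, ?_, ?_⟩
      · rw [hP, hMeq', mapGL_lt_mapGL_iff, ← htL, mapGL_lt_mapGL_iff]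
        exact hXlt
      · rw [hP, hdM, latticeDepth_mapGL_of_mem_unitaryInt hκ, latticeDepth_latt_diagonal_zpow_selfDual hd.vϖ, Int.natAbs_natCast]

end Literature.NumberTheory.Automorphic.UnitaryLatticeTree

end
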